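import Summits.BirchSwinnertonDyer.BirchSwinnertonDyer.Theses.TangentCone

/-!
# Route TangentCone — assembly item `Assembly`

`Assembly := EdgeDecay → EdgeCap → SelmerRankLB → SelmerRankShaPFinite → SelmerRankSmallImage →
RankLeOne → BirchSwinnertonDyer` is literally the type of the route's certified deciding theorem
`Summit.BirchSwinnertonDyer.BirchSwinnertonDyer.Theses.TangentCone.closes`; this file closes the
assembly item stmt-BirchSwinnertonDyer-17611 by that theorem. Nothing else is here: the mathematics
of the glue (Greenberg's corank identity `selmerCorank_eq_mordellWeilRank_add_holds`, `shaCorank = 0`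
for finite `Ш[p^∞]`, the proved prime supply `exists_good_ordinary_prime_holds`, invariance of both
ranks under a variable change and the global minimal model `hasGlobalMinimalModel_rat_holds`) lives
in `closes` itself.
-/

namespace Summit.BirchSwinnertonDyer.BirchSwinnertonDyer.Theorems

/-- The assembly item of route TangentCone: the two tangent-cone cruxes `EdgeDecay` (edge critical
values of the Hida branch decay at rate ≤ the analytic rank) and `EdgeCap` (they decay at rate ≥ the
`p^∞`-Selmer corank), together with the Selmer-rank inputs `SelmerRankLB`, `SelmerRankShaPFinite`,
`SelmerRankSmallImage` and the rank ≤ 1 leaf `RankLeOne`, imply `BirchSwinnertonDyer`. This is the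
type of the route's deciding theorem `TangentCone.closes`, so the proof is that theorem. -/
theorem tangentCone_assembly_proof :
    Summit.BirchSwinnertonDyer.BirchSwinnertonDyer.Theses.TangentCone.Assembly := by
  unfold Summit.BirchSwinnertonDyer.BirchSwinnertonDyer.Theses.TangentCone.Assembly
  exact Summit.BirchSwinnertonDyer.BirchSwinnertonDyer.Theses.TangentCone.closes

end Summit.BirchSwinnertonDyer.BirchSwinnertonDyer.Theorems
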